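import Mathlib

/-!
# Linear ray, cusp transformation I — the two theta families, termwise derivatives, the Jacobi identity
(part 1 of 4 of `LinearRayCusp`)

`F k x = Σ_{n∈ℤ}(−πn²)^k e^{−πn²x}`, `G k W = Σ_{n∈ℤ}(−π(n+½)²)^k e^{−π(n+½)²W}` on `Re > 0`: `(F k)' = F (k+1)`,
`(G k)' = G (k+1)` (Mathlib `hasDerivAt_tsum_of_isPreconnected`); `F 0 x = (x − i)^{−1/2} G 0 ((x − i)⁻¹)`
(Gaussian Poisson summation `Complex.tsum_exp_neg_quadratic` with `b = i/2`, using `e^{iπn(n+1)} = 1`); by the chain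
rule and uniqueness of derivatives `F 1 = H1`, `F 2 = H2` (explicit in `G 0, G 1, G 2` at `(x − i)⁻¹`). Mathlib only.
The `def`s are DATA (explicit series / explicit derivative expressions), no `Prop` is defined.
HONEST LABEL: a refutation of an RH-STRENGTHENING conjunct (the linear-factor ray); RH-free; nothing here bears on the truth of RH.
Provenance: rh-splitx-eng-5 g2 (cell rh-split, D-0116 arm; C15 / S-dbn-1 filler → kernel), monolith HOME/rh-splitx-eng-5/dbn/LinearRayCusp.lean; references: C. G. J. Jacobi (imaginary transformation of ϑ), B. Riemann / E. C. Titchmarsh §10.1 (Φ and Ξ), N. G. de Bruijn, Duke Math. J. 17 (1950) (Φ as analytic kernel).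

FILING DELTA (lead RULING #49, flag F1, lean/CONVENTIONS.md §2): outer namespace `Summit.RiemannHypothesis.RiemannHypothesis.Theorems.Splittings.LinearRayCusp` added — `CuspTransform` is nested inside it (namespace/`open` lines only; decl text unchanged).
-/

noncomputable section

set_option linter.dupNamespace false

open Complex Real Set Filter Topology

namespace Summit.RiemannHypothesis.RiemannHypothesis.Theorems.Splittings.LinearRayCusp

namespace CuspTransform


/-- The term `(−π q)^k · e^{−π q x}` for a real "frequency" `q ≥ 0`. -/
def eterm (q : ℝ) (k : ℕ) (x : ℂ) : ℂ := (-(π : ℂ) * q) ^ k * cexp (-(π : ℂ) * q * x)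

/-- `d/dx eterm q k = eterm q (k+1)`. -/
theorem hasDerivAt_eterm (q : ℝ) (k : ℕ) (x : ℂ) :
    HasDerivAt (eterm q k) (eterm q (k + 1) x) x := by
  unfold eterm
  have h1 : HasDerivAt (fun x : ℂ => -(π : ℂ) * q * x) (-(π : ℂ) * q) x := by
    simpa using (hasDerivAt_id x).const_mul (-(π : ℂ) * q)
  have h2 := h1.cexp.const_mul ((-(π : ℂ) * q) ^ k)
  have e : (-(π : ℂ) * q) ^ (k + 1) * cexp (-(π : ℂ) * q * x) =
      (-(π : ℂ) * q) ^ k * (cexp (-(π : ℂ) * q * x) * (-(π : ℂ) * q)) := by ring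
  rw [e]
  exact h2

/-- `‖eterm q k x‖ = (πq)^k e^{−πq·Re x}`. -/
theorem norm_eterm (q : ℝ) (hq : 0 ≤ q) (k : ℕ) (x : ℂ) :
    ‖eterm q k x‖ = (π * q) ^ k * Real.exp (-(π * q * x.re)) := by
  unfold eterm
  rw [norm_mul, norm_pow, Complex.norm_exp]
  congr 1
  · rw [norm_mul, norm_neg, Complex.norm_real, Complex.norm_real, Real.norm_of_nonneg pi_pos.le,
      Real.norm_of_nonneg hq]
  · congr 1
    simp [Complex.mul_re]

/-- Uniform bound for `eterm` on the half-plane `Re x > δ`. -/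
theorem norm_eterm_le (q : ℝ) (hq : 0 ≤ q) (k : ℕ) {δ : ℝ} {x : ℂ} (hx : δ < x.re) :
    ‖eterm q k x‖ ≤ (π * q) ^ k * Real.exp (-(π * q * δ)) := by
  rw [norm_eterm q hq k x]
  refine mul_le_mul_of_nonneg_left (Real.exp_le_exp.2 ?_) (by positivity)
  have : π * q * δ ≤ π * q * x.re := mul_le_mul_of_nonneg_left hx.le (by positivity)
  linarith

/-- The open half-plane `Re > δ`. -/
def halfPlane (δ : ℝ) : Set ℂ := {x : ℂ | δ < x.re}

/-- The half-plane `Re > δ` is open. -/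
theorem isOpen_halfPlane (δ : ℝ) : IsOpen (halfPlane δ) :=
  isOpen_lt continuous_const Complex.continuous_re

/-- The half-plane `Re > δ` is convex. -/
theorem convex_halfPlane (δ : ℝ) : Convex ℝ (halfPlane δ) := by
  simpa [halfPlane] using convex_halfSpace_re_gt δ

/-- The half-plane `Re > δ` is preconnected. -/
theorem isPreconnected_halfPlane (δ : ℝ) : IsPreconnected (halfPlane δ) :=
  (convex_halfPlane δ).isPreconnected

/-- **Termwise differentiation** of `x ↦ Σ_n c·eterm (q n) k x` on `Re > 0`, given Gaussian-type
summable majorants on every half-plane `Re > δ`, `δ > 0`. -/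
theorem hasDerivAt_tsum_eterm (q : ℤ → ℝ) (hq : ∀ n, 0 ≤ q n) (k : ℕ)
    (hsum : ∀ δ : ℝ, 0 < δ → ∀ j : ℕ, Summable fun n : ℤ => (π * q n) ^ j * Real.exp (-(π * q n * δ)))
    {x : ℂ} (hx : 0 < x.re) :
    HasDerivAt (fun z : ℂ => ∑' n : ℤ, eterm (q n) k z) (∑' n : ℤ, eterm (q n) (k + 1) x) x := by
  set δ : ℝ := x.re / 2 with hδ
  have hδpos : 0 < δ := by rw [hδ]; linarith
  have hxδ : x ∈ halfPlane δ := by simp only [halfPlane, mem_setOf_eq, hδ]; linarith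
  refine hasDerivAt_tsum_of_isPreconnected (u := fun n : ℤ => (π * q n) ^ (k + 1) * Real.exp (-(π * q n * δ)))
    (g := fun n z => eterm (q n) k z) (g' := fun n z => eterm (q n) (k + 1) z) (t := halfPlane δ) (y₀ := x)
    (hsum δ hδpos (k + 1)) (isOpen_halfPlane δ) (isPreconnected_halfPlane δ)
    (fun n y _ => hasDerivAt_eterm (q n) k y) (fun n y hy => norm_eterm_le (q n) (hq n) (k + 1) hy) hxδ ?_ hxδ
  -- summability of the series itself at x: dominated by the majorant with exponent k on Re > δ
  refine Summable.of_norm_bounded (hsum δ hδpos k) fun n => ?_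
  exact norm_eterm_le (q n) (hq n) k hxδ

/-! ## The two families -/

/-- `F k x = Σ_{n∈ℤ} (−πn²)^k e^{−πn²x}` (`k`-th `x`-derivative of `θ₃`). -/
def F (k : ℕ) (x : ℂ) : ℂ := ∑' n : ℤ, eterm ((n : ℝ) ^ 2) k x

/-- `G k W = Σ_{n∈ℤ} (−π(n+½)²)^k e^{−π(n+½)²W}` (`k`-th derivative of `Θ₂`). -/
def G (k : ℕ) (W : ℂ) : ℂ := ∑' n : ℤ, eterm (((n : ℝ) + 1 / 2) ^ 2) k W

/-- Gaussian majorant for the integer family: `Σ_n (πn²)^j e^{−πn²δ} < ∞`. -/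
theorem summable_F_majorant {δ : ℝ} (hδ : 0 < δ) (j : ℕ) :
    Summable fun n : ℤ => (π * (n : ℝ) ^ 2) ^ j * Real.exp (-(π * (n : ℝ) ^ 2 * δ)) := by
  have h := (summable_pow_mul_jacobiTheta₂_term_bound 0 hδ (2 * j)).mul_left (π ^ j)
  refine h.congr fun n => ?_
  have habs : ((|n| : ℤ) : ℝ) ^ (2 * j) = ((n : ℝ) ^ 2) ^ j := by
    rw [Int.cast_abs, pow_mul, sq_abs]
  rw [habs, mul_pow]
  simp only [mul_zero, zero_mul, sub_zero]
  ring_nf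

/-- Gaussian majorant for the half-integer family: `Σ_n (π(n+½)²)^j e^{−π(n+½)²δ} < ∞`
(reindex `n ↦ 2n+1`: `(n+½)² = (2n+1)²/4`, a subseries of the integer family at `δ/4`). -/
theorem summable_G_majorant {δ : ℝ} (hδ : 0 < δ) (j : ℕ) :
    Summable fun n : ℤ => (π * ((n : ℝ) + 1 / 2) ^ 2) ^ j * Real.exp (-(π * ((n : ℝ) + 1 / 2) ^ 2 * δ)) := by
  have hδ4 : 0 < δ / 4 := by linarith
  have h := ((summable_F_majorant hδ4 j).mul_left ((1 / 4 : ℝ) ^ j)).comp_injective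
    (i := fun n : ℤ => 2 * n + 1) (fun a b hab => by simpa using hab)
  refine h.congr fun n => ?_
  simp only [Function.comp_apply, Int.cast_add, Int.cast_mul, Int.cast_ofNat, Int.cast_one]
  have e : ((n : ℝ) + 1 / 2) ^ 2 = 1 / 4 * (2 * (n : ℝ) + 1) ^ 2 := by ring
  rw [e]
  have e2 : (π * (1 / 4 * (2 * (n : ℝ) + 1) ^ 2)) ^ j = (1 / 4 : ℝ) ^ j * (π * (2 * (n : ℝ) + 1) ^ 2) ^ j := by
    rw [← mul_pow]; congr 1; ring
  have e3 : π * (1 / 4 * (2 * (n : ℝ) + 1) ^ 2) * δ = π * (2 * (n : ℝ) + 1) ^ 2 * (δ / 4) := by ring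
  rw [e2, e3]
  ring

/-- `(F k)' = F (k+1)` on `Re > 0` (termwise differentiation). -/
theorem hasDerivAt_F (k : ℕ) {x : ℂ} (hx : 0 < x.re) : HasDerivAt (F k) (F (k + 1) x) x :=
  hasDerivAt_tsum_eterm (fun n : ℤ => (n : ℝ) ^ 2) (fun _ => sq_nonneg _) k
    (fun _ hδ j => summable_F_majorant hδ j) hx

/-- `(G k)' = G (k+1)` on `Re > 0` (termwise differentiation). -/
theorem hasDerivAt_G (k : ℕ) {W : ℂ} (hW : 0 < W.re) : HasDerivAt (G k) (G (k + 1) W) W :=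
  hasDerivAt_tsum_eterm (fun n : ℤ => ((n : ℝ) + 1 / 2) ^ 2) (fun _ => sq_nonneg _) k
    (fun _ hδ j => summable_G_majorant hδ j) hW



/-- `F₀(x) = Σ_{n∈ℤ} exp(−π n² x)`. -/
def F0 (x : ℂ) : ℂ := ∑' n : ℤ, cexp (-(π : ℂ) * (n : ℂ) ^ 2 * x)

/-- `G₀(W) = Σ_{n∈ℤ} exp(−π (n+½)² W)`. -/
def G0 (W : ℂ) : ℂ := ∑' n : ℤ, cexp (-(π : ℂ) * ((n : ℂ) + 1 / 2) ^ 2 * W)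

/-- `exp(π i n (n+1)) = 1` for every integer `n` (since `n(n+1)` is even). -/
theorem cexp_pi_I_mul_int_mul_succ (n : ℤ) : cexp ((π : ℂ) * I * ((n : ℂ) * ((n : ℂ) + 1))) = 1 := by
  obtain ⟨k, hk⟩ : ∃ k : ℤ, n * (n + 1) = 2 * k := by
    have : Even (n * (n + 1)) := Int.even_mul_succ_self n
    obtain ⟨k, hk⟩ := this
    exact ⟨k, by rw [hk]; ring⟩
  have : ((n : ℂ) * ((n : ℂ) + 1)) = 2 * (k : ℂ) := by exact_mod_cast hk
  rw [this, show (π : ℂ) * I * (2 * (k : ℂ)) = (k : ℂ) * (2 * π * I) by ring]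
  exact Complex.exp_int_mul_two_pi_mul_I k

/-- Termwise: `exp(−π n² x) = exp(−π (x − i) n² + 2π (i/2) n)`. -/
theorem term_shift (n : ℤ) (x : ℂ) :
    cexp (-(π : ℂ) * (n : ℂ) ^ 2 * x) =
      cexp (-(π : ℂ) * (x - I) * (n : ℂ) ^ 2 + 2 * π * (I / 2) * (n : ℂ)) := by
  have h : -(π : ℂ) * (x - I) * (n : ℂ) ^ 2 + 2 * π * (I / 2) * (n : ℂ) =
      -(π : ℂ) * (n : ℂ) ^ 2 * x + (π : ℂ) * I * ((n : ℂ) * ((n : ℂ) + 1)) := by ring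
  rw [h, Complex.exp_add, cexp_pi_I_mul_int_mul_succ, mul_one]

/-- **Steps (i)+(ii)**: for `Re x > 0`, `F₀(x) = (x − i)^{−1/2} · G₀((x − i)⁻¹)`. -/
theorem F0_eq (x : ℂ) (hx : 0 < x.re) :
    F0 x = (x - I) ^ (-(1 / 2 : ℂ)) * G0 (x - I)⁻¹ := by
  have ha : 0 < (x - I).re := by simpa using hx
  have h1 : F0 x = ∑' n : ℤ, cexp (-(π : ℂ) * (x - I) * (n : ℂ) ^ 2 + 2 * π * (I / 2) * (n : ℂ)) := by
    unfold F0
    exact tsum_congr fun n => term_shift n x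
  rw [h1, Complex.tsum_exp_neg_quadratic ha (I / 2)]
  have h2 : (1 : ℂ) / (x - I) ^ (1 / 2 : ℂ) = (x - I) ^ (-(1 / 2 : ℂ)) := by
    rw [Complex.cpow_neg, one_div]
  rw [h2]
  congr 1
  -- reindex n ↦ -n: (n + I (I/2))² = (n − 1/2)² = ((−n) + 1/2)²
  unfold G0
  rw [← (Equiv.neg ℤ).tsum_eq]
  refine tsum_congr fun n => ?_
  congr 1
  have hxI : x - I ≠ 0 := fun h => by rw [h] at ha; simp at ha
  simp only [Equiv.neg_apply, Int.cast_neg]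
  field_simp
  ring_nf
  simp only [Complex.I_sq, Complex.I_pow_four]
  ring


/-! ## Linking `F 0`, `G 0` with `F0`, `G0`, and the chain rule -/

/-- `F 0 = F₀` (the `k = 0` family is the plain theta series). -/
theorem F_zero_eq_F0 (x : ℂ) : F 0 x = F0 x := by
  unfold F F0 eterm
  refine tsum_congr fun n => ?_
  push_cast
  ring_nf

/-- `G 0 = G₀`. -/
theorem G_zero_eq_G0 (W : ℂ) : G 0 W = G0 W := by
  unfold G G0 eterm
  refine tsum_congr fun n => ?_
  push_cast
  ring_nf

/-- `Re(x − i) = Re x`. -/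
theorem sub_I_re (x : ℂ) : (x - I).re = x.re := by simp

/-- `x − i ≠ 0` when `Re x > 0`. -/
theorem sub_I_ne_zero {x : ℂ} (hx : 0 < x.re) : x - I ≠ 0 := by
  intro h
  have := congrArg Complex.re h
  simp at this
  linarith

/-- `x − i` lies in the slit plane when `Re x > 0`. -/
theorem sub_I_mem_slitPlane {x : ℂ} (hx : 0 < x.re) : x - I ∈ slitPlane :=
  Or.inl (by simpa using hx)

/-- `Re((x − i)⁻¹) > 0` when `Re x > 0`. -/
theorem inv_sub_I_re_pos {x : ℂ} (hx : 0 < x.re) : 0 < ((x - I)⁻¹).re := by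
  rw [Complex.inv_re, sub_I_re]
  exact div_pos hx (Complex.normSq_pos.2 (sub_I_ne_zero hx))

/-- `H₀(x) = (x − i)^{−1/2} G₀((x − i)⁻¹)` — the right-hand side of the Jacobi identity. -/
def H0 (x : ℂ) : ℂ := (x - I) ^ (-(1 / 2 : ℂ)) * G 0 (x - I)⁻¹

/-- `H₁ = H₀'`: `−½(x−i)^{−3/2}G₀(W) − (x−i)^{−1/2}(x−i)⁻²G₁(W)`, `W = (x−i)⁻¹`. -/
def H1 (x : ℂ) : ℂ :=
  -(1 / 2 : ℂ) * (x - I) ^ (-(3 / 2 : ℂ)) * G 0 (x - I)⁻¹ -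
    (x - I) ^ (-(1 / 2 : ℂ)) * ((x - I) ^ 2)⁻¹ * G 1 (x - I)⁻¹

/-- `H₂ = H₁'`: `¾(x−i)^{−5/2}G₀ + (x−i)^{−3/2}(x−i)⁻²G₁ + 2(x−i)^{−1/2}(x−i)⁻³G₁ + (x−i)^{−1/2}(x−i)⁻⁴G₂`. -/
def H2 (x : ℂ) : ℂ :=
  (3 / 4 : ℂ) * (x - I) ^ (-(5 / 2 : ℂ)) * G 0 (x - I)⁻¹ +
    (x - I) ^ (-(3 / 2 : ℂ)) * ((x - I) ^ 2)⁻¹ * G 1 (x - I)⁻¹ +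
    2 * (x - I) ^ (-(1 / 2 : ℂ)) * ((x - I) ^ 3)⁻¹ * G 1 (x - I)⁻¹ +
    (x - I) ^ (-(1 / 2 : ℂ)) * ((x - I) ^ 4)⁻¹ * G 2 (x - I)⁻¹

/-- `F 0 = H₀` on `Re > 0` (the Jacobi identity in the `F`/`G` notation). -/
theorem F_zero_eq_H0 {x : ℂ} (hx : 0 < x.re) : F 0 x = H0 x := by
  rw [F_zero_eq_F0, F0_eq x hx, H0, G_zero_eq_G0]

/-- derivative of `x ↦ (x − i)^p`. -/
theorem hasDerivAt_sub_I_cpow (p : ℂ) {x : ℂ} (hx : 0 < x.re) :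
    HasDerivAt (fun z : ℂ => (z - I) ^ p) (p * (x - I) ^ (p - 1)) x := by
  have h : HasDerivAt (fun z : ℂ => z - I) 1 x := (hasDerivAt_id x).sub_const I
  have := h.cpow_const (c := p) (sub_I_mem_slitPlane hx)
  simpa using this

/-- derivative of `x ↦ (x − i)⁻¹`. -/
theorem hasDerivAt_inv_sub_I {x : ℂ} (hx : 0 < x.re) :
    HasDerivAt (fun z : ℂ => (z - I)⁻¹) (-((x - I) ^ 2)⁻¹) x := by
  have h : HasDerivAt (fun z : ℂ => z - I) 1 x := (hasDerivAt_id x).sub_const I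
  refine (h.fun_inv (sub_I_ne_zero hx)).congr_deriv ?_
  rw [div_eq_mul_inv, neg_mul, one_mul]

/-- derivative of `x ↦ ((x − i)²)⁻¹`. -/
theorem hasDerivAt_inv_sub_I_sq {x : ℂ} (hx : 0 < x.re) :
    HasDerivAt (fun z : ℂ => ((z - I) ^ 2)⁻¹) (-2 * ((x - I) ^ 3)⁻¹) x := by
  have h0 : HasDerivAt (fun z : ℂ => z - I) 1 x := (hasDerivAt_id x).sub_const I
  have h : HasDerivAt (fun z : ℂ => (z - I) ^ 2) (2 * (x - I)) x := by
    refine (h0.fun_pow 2).congr_deriv ?_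
    simp
  have hne : (x - I) ^ 2 ≠ 0 := pow_ne_zero _ (sub_I_ne_zero hx)
  refine (h.fun_inv hne).congr_deriv ?_
  have hne1 : (x - I) ≠ 0 := sub_I_ne_zero hx
  field_simp

/-- derivative of `x ↦ G k ((x − i)⁻¹)`. -/
theorem hasDerivAt_G_comp (k : ℕ) {x : ℂ} (hx : 0 < x.re) :
    HasDerivAt (fun z : ℂ => G k (z - I)⁻¹) (G (k + 1) (x - I)⁻¹ * (-((x - I) ^ 2)⁻¹)) x := by
  have hG := hasDerivAt_G k (inv_sub_I_re_pos hx)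
  exact hG.comp x (hasDerivAt_inv_sub_I hx)

/-- `H₀' = H₁` on `Re > 0` (chain rule). -/
theorem hasDerivAt_H0 {x : ℂ} (hx : 0 < x.re) : HasDerivAt H0 (H1 x) x := by
  have h1 := hasDerivAt_sub_I_cpow (-(1 / 2 : ℂ)) hx
  have h2 := hasDerivAt_G_comp 0 hx
  have h := h1.mul h2
  have e : H1 x = -(1 / 2 : ℂ) * (x - I) ^ (-(1 / 2 : ℂ) - 1) * G 0 (x - I)⁻¹ +
      (x - I) ^ (-(1 / 2 : ℂ)) * (G (0 + 1) (x - I)⁻¹ * -((x - I) ^ 2)⁻¹) := by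
    rw [H1, show (-(1 / 2 : ℂ) - 1) = -(3 / 2 : ℂ) by norm_num]
    ring
  rw [e]
  exact h

/-- `H₁' = H₂` on `Re > 0` (chain rule). -/
theorem hasDerivAt_H1 {x : ℂ} (hx : 0 < x.re) : HasDerivAt H1 (H2 x) x := by
  have hA := ((hasDerivAt_sub_I_cpow (-(3 / 2 : ℂ)) hx).const_mul (-(1 / 2 : ℂ))).mul (hasDerivAt_G_comp 0 hx)
  have hB := (((hasDerivAt_sub_I_cpow (-(1 / 2 : ℂ)) hx).mul (hasDerivAt_inv_sub_I_sq hx)).mul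
    (hasDerivAt_G_comp 1 hx))
  have h := hA.sub hB
  have e : H2 x =
      (-(1 / 2 : ℂ) * (-(3 / 2 : ℂ) * (x - I) ^ (-(3 / 2 : ℂ) - 1)) * G 0 (x - I)⁻¹ +
          -(1 / 2 : ℂ) * (x - I) ^ (-(3 / 2 : ℂ)) * (G (0 + 1) (x - I)⁻¹ * -((x - I) ^ 2)⁻¹)) -
        ((-(1 / 2 : ℂ) * (x - I) ^ (-(1 / 2 : ℂ) - 1) * ((x - I) ^ 2)⁻¹ +
              (x - I) ^ (-(1 / 2 : ℂ)) * (-2 * ((x - I) ^ 3)⁻¹)) * G 1 (x - I)⁻¹ +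
          (x - I) ^ (-(1 / 2 : ℂ)) * ((x - I) ^ 2)⁻¹ * (G (1 + 1) (x - I)⁻¹ * -((x - I) ^ 2)⁻¹)) := by
    rw [H2, show (-(3 / 2 : ℂ) - 1) = -(5 / 2 : ℂ) by norm_num, show (-(1 / 2 : ℂ) - 1) = -(3 / 2 : ℂ) by norm_num]
    have hne : (x - I) ≠ 0 := sub_I_ne_zero hx
    have h4 : ((x - I) ^ 4)⁻¹ = ((x - I) ^ 2)⁻¹ * ((x - I) ^ 2)⁻¹ := by
      rw [← mul_inv, ← pow_add]
    rw [h4]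
    push_cast
    ring
  rw [e]
  exact h

/-- **`F 1 = H 1` on `Re > 0`** (uniqueness of derivatives: `F 0 = H 0` there). -/
theorem F_one_eq_H1 {x : ℂ} (hx : 0 < x.re) : F 1 x = H1 x := by
  have hF := hasDerivAt_F 0 hx
  have hH := hasDerivAt_H0 hx
  have heq : F 0 =ᶠ[𝓝 x] H0 := by
    have hopen : IsOpen (halfPlane 0) := isOpen_halfPlane 0
    filter_upwards [hopen.mem_nhds (show x ∈ halfPlane 0 from hx)] with z hz
    exact F_zero_eq_H0 hz
  exact (hF.congr_of_eventuallyEq heq.symm).unique hH |> fun h => by simpa using h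

/-- **`F 2 = H 2` on `Re > 0`**. -/
theorem F_two_eq_H2 {x : ℂ} (hx : 0 < x.re) : F 2 x = H2 x := by
  have hF := hasDerivAt_F 1 hx
  have hH := hasDerivAt_H1 hx
  have heq : F 1 =ᶠ[𝓝 x] H1 := by
    have hopen : IsOpen (halfPlane 0) := isOpen_halfPlane 0
    filter_upwards [hopen.mem_nhds (show x ∈ halfPlane 0 from hx)] with z hz
    exact F_one_eq_H1 hz
  exact (hF.congr_of_eventuallyEq heq.symm).unique hH

end CuspTransform

end Summit.RiemannHypothesis.RiemannHypothesis.Theorems.Splittings.LinearRayCusp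

end
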